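import Summits.QuantumFields.QCD.Theses.DiagonalSpine
import HarnessLib.Audit

/-!
# Birth skeleton (BC3) for the crux `FullLatticeGap` (item stmt-QuantumFields-8928)

Route `DiagonalSpine` (sub-problem QCD), crux decl `Summit.QuantumFields.QCD.Theses.DiagonalSpine.FullLatticeGap`
(rev 12, rank 2; THE LATTICE HALF of the spine, shared with `GapBuysCauchyRate` (crux r3) and `CentreStabilisedCircle`
(support r9)):

  `∀ Nf, Nf = 2 ∨ Nf = 3 → ∃ reg : QCDRegularisation Nf, reg.HasMassScaling ∧ (reg.scheme 0 0 0).HasAsymptoticScaling ∧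
     ∀ m, (∀ f, 0 < m f) → (∀ f, ∀ᶠ k in atTop, -1 < (reg.scheme m 0 0).mq f k) ∧ ∃ Δ > 0, (reg.scheme m 0 0).HasLatticeMassGap Δ`.

Registered by the skeleton-registrar seat `planner-skel-stmt-QuantumFields-8928-0` (route re-audit bin REPAIRABLE,
2026-08-17) as `Cruxes/FullLatticeGap/Lines/birth.lean`.  It is the route-level BIRTH CERTIFICATE of the crux (≥ 2 named
stubs, a kernel-checked composition concluding the crux BY NAME, `sorry` only inside `stub_*`), deliberately LINE-NEUTRAL
and cut along the route header's OWN reading of this node: "`m_crit` is free witness data in FullLatticeGap, so its `reg`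
may be DECOUPLED (heavy quarks in lattice units)" (header, LIGHT QUARKS gen-2 repair; the honest light-quark content is the
separate node `LightQuarkGap`), and the crux's recorded why-it-might-fail: "a heavy-quark witness (m_crit ≡ 20: κ < 1/48,
hopping domain, det > 0) reduces it to uniform clustering of lattice SU(3) YM along some β_k → ∞ with
ξ_lat ≤ C·e^{β_k/(4b₀(N_f))} — the weak-coupling lattice YM gap, open".  That reduction, typed, is a BRIDGE SPLIT
`T ∧ (T → HeavyWilsonGapLaw)` with `T` substantive and open (the human-blessed shape of BC2/BC3: `T` alone gives neither the
crux nor `QCD`), plus a DECOUPLED SCAFFOLD that is PROVED here (glue, not a stub):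

* `stub_ymLatticeGapAlongAFSequences : Stmt.stub_ymLatticeGapAlongAFSequences` (open-problem; the YANG–MILLS INPUT) — for
  all scaling data (`a_k > 0`, `a_k → 0`, `a_k L_k → ∞`) and EVERY coupling sequence `β'` with `N_f = 0` two-loop
  asymptotic scaling (`∃ Λ' > 0, β'_k − afBeta 0 Λ' a_k → 0`), lattice `SU(3)` Yang–Mills with Wilson's action in the
  fundamental representation has a lattice gap `Δ' > 0` in the units set by `a_k`, uniformly in the volume (all
  gauge-invariant local observables `A B : YMSpecies SU(3)`, every torus `2S+1 ≥ 2L_k+1`, `n ≤ S`, eventually in `k`).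
  BYTE-IDENTICAL with the vetted item `HeavyThresholdYMBridge.YMLatticeGapAlongAFSequences` (stmt-QuantumFields-8796,
  support r6 of route-QuantumFields-HeavyThresholdYMBridge, grounded open-problem): one proof closes both (`Iff.rfl`,
  checked in the seat's `bc/probes.lean`; no cross-route import here on purpose).
* `stub_heavyQuarkDecoupling : Stmt.stub_heavyQuarkDecoupling` (open-problem; the DECOUPLING BRIDGE) —
  `Stmt.stub_ymLatticeGapAlongAFSequences → HeavyWilsonGapLaw`, where `HeavyWilsonGapLaw` is the scheme-level LAW: for
  `N_f ∈ {2,3}` there is a lattice-mass floor `M₀` such that EVERY sequential lattice-QCD scheme with `N_f`-flavour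
  two-loop asymptotic scaling whose bare Wilson masses are eventually `≥ M₀` (quarks heavy IN LATTICE UNITS, hopping
  parameters `κ_f(k) ≤ 1/(2M₀+8)` inside the background-uniform convergence domain) has a uniform lattice mass gap
  `∃ Δ > 0, sch.HasLatticeMassGap Δ`.  Intended mechanism: configuration-uniform hopping expansion of the Wilson
  determinant and of all quark lines (the PROVED barrier `Literature.Barriers.QuantumFields.HoppingExpansionUniformGap` is a
  RESOURCE here: quark-line channels decay at lattice rate `≥ log(1/θ)`, i.e. at physical rate `→ ∞`), the gluonic
  effective action `β_k S_W + O(N_f κ⁴)·(plaquettes) + (longer loops)`, the YM input at the re-parametrised spacing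
  `b_k := (afBeta 0 1)⁻¹(β_eff,k)` (`b_k/a_k → ∞` because `b₀(0) > b₀(N_f)`, so a gap in `b_k`-units is a gap in
  `a_k`-units — the ξ_lat ≤ C e^{β_k/(4b₀(N_f))} of the why-it-might-fail), and the positive heavy determinant
  (no sign problem at `κ h < 1`).  DISCLOSED WEAKNESS (the same as the vetted crux `HeavyThresholdYMBridge.HeavyLatticeGapFromYM`,
  stmt-QuantumFields-8795, records in its why-it-might-fail): the hypothesis `T` is per-pair-constant clustering of the
  UNPERTURBED Wilson action only — no robustness in the action direction, no control of `C(A, B)` over quasi-local loop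
  functionals — so a proof of the bridge will in effect need `T` in a robust form (the tree's typed strengthening is
  `RobustYangMills`, stmt-QuantumFields-13897, over `QuasiLocalGaugePerturbation`); as an implication between two
  statements both expected true it is plausibly TRUE, and it is strictly weaker than the unconditional law.

`FullLatticeGap_of : Stmt.stub_ymLatticeGapAlongAFSequences → Stmt.stub_heavyQuarkDecoupling → FullLatticeGap` is
kernel-checked: modus ponens gives `HeavyWilsonGapLaw`; at `N_f ∈ {2,3}` take its floor `M₀` and the DECOUPLED SCAFFOLD
`decoupledReg N_f (max M₀ 0)` — the tree's `QCDRegularisation.canonicalAF N_f` (`a_k = 1/(k+1)`, `L_k = (k+1)²`,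
`β_k = afBeta N_f 1 a_k`, `Z_m(k) = (log a_k⁻²)^{γ₀/(2β₀)}`) with the critical mass PARKED at the constant lattice value
`max M₀ 0`; it has leading-log mass scaling (`canonicalAF_hasMassScaling`, `Z_m` untouched), exact two-loop asymptotic
scaling of every one of its schemes (`β_k − afBeta N_f 1 a_k ≡ 0`), and for every non-negative tuple `m` the bare masses
`m_f(k) = max M₀ 0 + a_k m_f/Z_m(k) ≥ max M₀ 0` for ALL `k` (`le_decoupledReg_mq`) — hence the physical branch
(`> −1`) and the floor (`≥ M₀`), and the law hands the gap.  `fullLatticeGap_of_stubs` instantiates it.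
Naming: the statement of stub `stub_<name>` is `def Stmt.stub_<name> : Prop` (so `ledger skeleton check` admits the
hypotheses of `FullLatticeGap_of` as declared stubs by name — crux workfiles may not carry `@[stub]`).

## Why this cut and not another (recorded for the crux's ideators)
* The crux as typed is ONE indivisible open problem modulo non-existent technology (weak-coupling lattice YM clustering
  with decoupled quarks); every two-piece cut is (bookkeeping + content), (index slicing `N_f = 2 / 3`), or a bridge.  The
  bridge is chosen because both stubs are substantive, it is the crux's own recorded reduction, and it re-uses the vetted
  decomposition of the neighbouring route (`8796` verbatim, `8795` in scheme-law form with the physical-branch clause that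
  `8795`'s conclusion lacks and that no threshold shift can supply: `a_k M/Z_m(k) → 0`).
* `HasLatticeMassGap`-type hypotheses (`∃ C` per observable pair, strictly local observables) are UNUSABLE for any soft
  transfer (gluonic ⇒ fermionic channels, volume sequence ⇒ all volumes needs a common rate, mass `m ⇒ m'`, action
  perturbations): hairpin/disconnected pieces are quasi-local series whose per-term constants are uncontrolled.  A cut
  that wants a USABLE Yang–Mills hypothesis must type constants uniform over normalised observables of given support AND
  robustness under small summable loop perturbations of the action — `RobustYangMills`/`QuasiLocalGaugePerturbation`.
* The law is stated with `∃ Δ > 0` (the crux's clause shape) although the decoupled corner is expected to satisfy it for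
  EVERY `Δ` (`ξ_glue(β_k)·a_k → 0`, `FixedCouplingUltralocality` as a resource): weakest form that composes.

## Negative knowledge honoured (read 2026-08-17)
* `Cruxes/FullLatticeGap/` had NO workfiles before this one (no `Disproof.lean`, no ideas, no dead lines); the item's
  evidence is the MultibosonBridge planner memo `rev7_memo.md` (after the re-type, `LatticeToContinuum := FullLatticeGap →
  QCD` asks chirality of a possibly PARKED `reg`; a pinned lattice half `FullLatticeGapC`, stmt-QuantumFields-17619, exists)
  — route-shape business for the tenure planner; this skeleton registers the crux AS FILED (m_crit free), and says so.
* `ledger negatives --problem QuantumFields` (5 entries): RobustYangMillsRG stmt-14958 (a wild blocking map inhabits an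
  under-constrained admissibility predicate — NOT the lattice statement `T` used here, and not `RobustYangMills` 13897);
  MirrorModularBoosts stmt-9665; AdaptiveCoarseSystem stmt-9494; MultibosonLatticeGap stmt-9599 (the look-alike of this
  crux — died on its multiboson `Adm` clause only, no bearing: retriage g1–g3); AdmissibleRootsExist stmt-9603.  Lesson
  applied: NO bespoke admissibility predicate anywhere — `T` is the vetted 8796 verbatim, the law quantifies over the
  Statement's own `QCDScheme`/`HasAsymptoticScaling`/`HasLatticeMassGap`, the scaffold is the tree's `canonicalAF`.
* Landed Negative lemmas nearby (imported by nobody here, read): `RobustYangMills/Negative/NoSmallFalse.lean`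
  (`robustYangMills_imp_wilson`: 13897 ⊇ the Wilson package along every a.f. sequence — consistent with using the weaker
  `T`), `RobustYangMillsHandover/Negative/SchemeAsymptotics.lean` (`tendsto_massIncrement_zero`: `a_k m/Z_m(k) → 0` — why
  the floor must sit in `m_crit`, as in `decoupledReg`), `…/HoppingWindow.lean` (the hopping series diverges on constant
  modes for `m ≤ 0` — why the floor is a POSITIVE lattice mass, `max M₀ 0`).
* Junk/vacuity (typing checklist 4c, A1–A6): the law reads `sch.mq`, `sch.β` only eventually (`∀ᶠ k` inside
  `HasLatticeMassGap`), so early junk masses/couplings are harmless; at `κ h < 1` every `det (1 − κ M[U]) > 0`, so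
  `qcdTorusExpect` is not the junk `0/0`; no Bochner integral over a free function, no hand-picked rate (`M₀, Δ, Δ'`
  existential), no complex-action positivity claim; `N_f` restricted to `{2,3}` as in the crux (no `b₀ ≤ 0` regime).

## BC3 probes (planner folder `bc/probes.lean`): for each stub statement `S`, `S → FullLatticeGap` and `S → QCD` by
`first | exact? | simpa | aesop` FAIL (statements copied verbatim with no stub or composition in scope; rc and goals in
the seat's NOTES.md and in `Lines/birth.md`).
-/

noncomputable section

namespace Summit.QuantumFields.QCD.Cruxes.FullLatticeGap.Birth

open scoped Topology
open Filter
open Literature.MathematicalPhysics.QuantumFieldTheory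
open Summit.QuantumFields.QCD.Theses.DiagonalSpine

/-! ## §0 Currency (the Statement's vocabulary only) -/

/-- **The decoupled scaffold at lattice-mass floor `M`**: the tree's canonical asymptotically free regularisation
`QCDRegularisation.canonicalAF N_f` (`a_k = 1/(k+1)`, `L_k = (k+1)²`, `β_k = afBeta N_f 1 a_k`,
`Z_m(k) = (log a_k⁻²)^{γ₀/(2β₀)}`, `k ≥ 1`) with the flavour-blind critical bare mass PARKED at the constant lattice value
`M` — quarks of renormalised mass `m_f` sit at bare lattice mass `M + a_k m_f/Z_m(k) ≥ M`, i.e. infinitely heavy in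
physical units (the decoupled corner the crux admits because `m_crit` is free witness data). [folklore] -/
def decoupledReg (Nf : ℕ) (M : ℝ) : QCDRegularisation Nf :=
  { QCDRegularisation.canonicalAF Nf with mcrit := fun _ => M }

/-- **Heavy-Wilson-quark lattice gap law along asymptotic scaling** (the consequent of the decoupling bridge): for
`N_f ∈ {2, 3}` there is a lattice-mass floor `M₀` such that every sequential lattice-QCD scheme (`a_k → 0`,
`a_k L_k → ∞`) with `N_f`-flavour two-loop asymptotic scaling of `β_k` and bare Wilson masses eventually `≥ M₀`
(uniformly heavy in lattice units) has a uniform lattice mass gap `Δ > 0` in physical units — all gauge-invariant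
local lattice QCD observables, every torus `2S+1 ≥ 2L_k+1`, uniformly in the volume (`QCDScheme.HasLatticeMassGap`).
Content: the weak-coupling lattice `SU(3)` Yang–Mills gap with `ξ_lat(β_k) = o(a_k⁻¹)` plus decoupling of heavy Wilson
quarks (hopping domain, positive determinant). -/
def HeavyWilsonGapLaw : Prop :=
  ∀ Nf : ℕ, Nf = 2 ∨ Nf = 3 → ∃ M₀ : ℝ, ∀ sch : QCDScheme Nf, sch.HasAsymptoticScaling →
    (∀ f, ∀ᶠ k in atTop, M₀ ≤ sch.mq f k) → ∃ Δ > 0, sch.HasLatticeMassGap Δ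

/-! ## §1 The two stub statements (`Stmt.stub_<name>` is the statement of the stub `stub_<name>`) -/

/-- **(S1) Lattice `SU(3)` Yang–Mills gap along EVERY `N_f = 0` asymptotically scaling Wilson sequence** (open-problem;
BYTE-IDENTICAL with `HeavyThresholdYMBridge.YMLatticeGapAlongAFSequences`, stmt-QuantumFields-8796).  For all scaling
data (`a_k > 0`, `a_k → 0`, `a_k L_k → ∞`) and every coupling sequence `β'` with `∃ Λ' > 0, β'_k − afBeta 0 Λ' a_k → 0`,
Wilson's lattice `SU(3)` theory in the fundamental representation has a lattice gap `Δ' > 0` in the units set by `a_k`,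
uniformly in the volume: for all gauge-invariant local observables `A, B` there is `C` with
`|⟨A·τ_n B⟩ − ⟨A⟩⟨B⟩| ≤ C e^{−Δ' a_k n}` on every torus of side `2S+1 ≥ 2L_k+1`, `n ≤ S`, eventually in `k`.  Why
plausibly true: dimensional transmutation — the pure-gauge correlation length scales like `e^{β/(4b₀(0))}`, i.e.
`≍ a_k⁻¹` along an `N_f = 0` a.f. sequence, and confinement/gap at every finite `β` on the symmetric torus.  Why it
might fail: it is the lattice half of the Clay Yang–Mills gap at `G = SU(3)` strengthened from `∃` scheme to `∀`
a.f. Wilson sequence (β-universality); rigorous gaps exist only at strong coupling (Osterwalder–Seiler); false if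
`ξ_lat = ∞` beyond some `β_c` (Patrascioiu–Seiler).  Size: open-problem. -/
def Stmt.stub_ymLatticeGapAlongAFSequences : Prop :=
  ∀ (a : ℕ → ℝ) (L : ℕ → ℕ), (∀ k, 0 < a k) → Filter.Tendsto a Filter.atTop (nhds 0) → Filter.Tendsto (fun k => a k * L k) Filter.atTop Filter.atTop → ∀ β' : ℕ → ℝ, (∃ Λ' : ℝ, 0 < Λ' ∧ Filter.Tendsto (fun k => β' k - Literature.MathematicalPhysics.QuantumFieldTheory.afBeta 0 Λ' (a k)) Filter.atTop (nhds 0)) → ∃ Δ' : ℝ, 0 < Δ' ∧ ∀ A B : Literature.MathematicalPhysics.QuantumFieldTheory.YMSpecies (Matrix.specialUnitaryGroup (Fin 3) ℂ), ∃ C : ℝ, ∀ᶠ k in Filter.atTop, ∀ S : ℕ, L k ≤ S → ∀ n : ℕ, n ≤ S → |Literature.MathematicalPhysics.QuantumFieldTheory.latticeConnectedCorr (Literature.MathematicalPhysics.QuantumLattice.fundamentalRep (Fin 3)) (β' k) (2 * S + 1) A.F B.F n| ≤ C * Real.exp (-(Δ' * (a k * n)))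

/-- **(S2) Heavy-quark decoupling bridge** (open-problem): the Yang–Mills lattice gap along every `N_f = 0` a.f.
Wilson sequence (S1) implies the heavy-Wilson-quark lattice gap law along `N_f`-flavour asymptotic scaling
(`HeavyWilsonGapLaw`).  Why plausibly true: for bare masses `≥ M₀` with `(16√3)/(2M₀+8) < 1` the hopping expansion of
`det (1 − κ M[U])^{N_f}` and of every quark line converges uniformly in the gauge field (tree:
`HoppingExpansionUniformGap_holds`), quark-line channels decay at lattice rate `≥ log(1/θ)` (physical rate `→ ∞`), the
determinant is positive, and the gluonic sector is Wilson's action at `β_k + O(N_f κ⁴)` plus exponentially small longer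
loops — an `N_f`-profile coupling sequence in `a_k`-units, i.e. an `N_f = 0`-profile sequence at the re-parametrised
spacing `b_k = (afBeta 0 1)⁻¹(β_eff,k)` with `b_k/a_k → ∞` (`b₀(0) > b₀(N_f)`), where (S1) supplies a gap in
`b_k`-units, a fortiori in `a_k`-units.  Why it might fail / disclosed weakness: (S1) is per-pair-constant clustering of
the UNPERTURBED Wilson action — it controls neither the longer-loop perturbation of the action nor the constants of the
quasi-local hairpin functionals, so the bridge is "in effect the unconditional heavy-Wilson-quark lattice gap at weak
coupling" (verbatim the caveat of the vetted crux stmt-QuantumFields-8795) unless (S1) is used in the robust form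
`RobustYangMills` (stmt-QuantumFields-13897).  Size: open-problem (L given robust YM). -/
def Stmt.stub_heavyQuarkDecoupling : Prop :=
  Stmt.stub_ymLatticeGapAlongAFSequences → HeavyWilsonGapLaw

/-! ## §2 The registered stubs (the ONLY `sorry`s of this file) -/

/-- (S1) lattice `SU(3)` Yang–Mills gap along every `N_f = 0` a.f. Wilson sequence — open-problem (= stmt-8796). -/
theorem stub_ymLatticeGapAlongAFSequences : Stmt.stub_ymLatticeGapAlongAFSequences := by
  sorry

/-- (S2) heavy-quark decoupling bridge — open-problem. -/
theorem stub_heavyQuarkDecoupling : Stmt.stub_heavyQuarkDecoupling := by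
  sorry

/-! ## §3 Glue: the decoupled scaffold (PROVED) and the composition (kernel-checked; no `sorry` below this line) -/

section Scaffold

variable {Nf : ℕ} {M : ℝ}

/-- The parked critical mass. [folklore] -/
@[simp] theorem decoupledReg_mcrit (k : ℕ) : (decoupledReg Nf M).mcrit k = M := rfl

/-- Leading-log mass scaling of the scaffold (its `Z_m`, `a` are `canonicalAF`'s). [folklore] -/
theorem decoupledReg_hasMassScaling : (decoupledReg Nf M).HasMassScaling := by
  obtain ⟨c, hc, h⟩ :=
    (QCDRegularisation.canonicalAF_hasMassScaling : (QCDRegularisation.canonicalAF Nf).HasMassScaling)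
  exact ⟨c, hc, h⟩

/-- Every scheme of the scaffold scales asymptotically, EXACTLY (`β_k = afBeta N_f 1 a_k`, `Λ = 1`). [folklore] -/
theorem decoupledReg_scheme_hasAsymptoticScaling (m : Fin Nf → ℝ) (z shift : QCDField Nf → ℕ → ℝ) :
    ((decoupledReg Nf M).scheme m z shift).HasAsymptoticScaling := by
  have h : ∀ k, ((decoupledReg Nf M).scheme m z shift).β k =
      afBeta Nf 1 (((decoupledReg Nf M).scheme m z shift).a k) := fun k => rfl
  refine ⟨1, one_pos, ?_⟩
  simp only [h, sub_self]
  exact tendsto_const_nhds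

/-- The bare masses of the scaffold sit above the floor for every non-negative tuple and EVERY `k`:
`m_f(k) = M + a_k m_f / Z_m(k) ≥ M`. [folklore] -/
theorem le_decoupledReg_mq {m : Fin Nf → ℝ} (hm : ∀ f, 0 ≤ m f) (f : Fin Nf) (k : ℕ) :
    M ≤ ((decoupledReg Nf M).scheme m 0 0).mq f k := by
  rw [QCDRegularisation.scheme_mq, decoupledReg_mcrit]
  exact le_add_of_nonneg_right
    (div_nonneg (mul_nonneg ((decoupledReg Nf M).a_pos k).le (hm f)) ((decoupledReg Nf M).Zm_pos k).le)

end Scaffold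

/-- **The crux from the two stubs** (concludes `FullLatticeGap` BY NAME).  Modus ponens gives the heavy law; at
`N_f ∈ {2,3}` its floor `M₀` is realised by the decoupled scaffold `decoupledReg N_f (max M₀ 0)`: leading-log mass
scaling, exact asymptotic scaling, bare masses `≥ max M₀ 0 ≥ 0 > −1` for every positive tuple and every `k` (physical
branch and floor), and the law hands `∃ Δ > 0, HasLatticeMassGap Δ` for the scheme of every positive tuple. -/
theorem FullLatticeGap_of :
    Stmt.stub_ymLatticeGapAlongAFSequences → Stmt.stub_heavyQuarkDecoupling → FullLatticeGap := by
  intro hYM hDec Nf hNf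
  obtain ⟨M₀, hM₀⟩ := hDec hYM Nf hNf
  refine ⟨decoupledReg Nf (max M₀ 0), decoupledReg_hasMassScaling,
    decoupledReg_scheme_hasAsymptoticScaling 0 0 0, fun m hm => ?_⟩
  have hmq : ∀ f k, max M₀ 0 ≤ ((decoupledReg Nf (max M₀ 0)).scheme m 0 0).mq f k :=
    le_decoupledReg_mq fun f => (hm f).le
  refine ⟨fun f => Eventually.of_forall fun k => ?_, ?_⟩
  · exact lt_of_lt_of_le neg_one_lt_zero ((le_max_right M₀ 0).trans (hmq f k))
  · exact hM₀ _ (decoupledReg_scheme_hasAsymptoticScaling m 0 0)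
      fun f => Eventually.of_forall fun k => (le_max_left M₀ 0).trans (hmq f k)

/-- The crux along this skeleton, from the registered stubs (sorries only inside `stub_*`). -/
theorem fullLatticeGap_of_stubs : FullLatticeGap :=
  FullLatticeGap_of stub_ymLatticeGapAlongAFSequences stub_heavyQuarkDecoupling

end Summit.QuantumFields.QCD.Cruxes.FullLatticeGap.Birth

end
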